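import Summits.CriticalPhenomena.PercolationContinuityZ3.Theorems.Transplant.SharpnessSeriesLawZd
import Summits.CriticalPhenomena.PercolationContinuityZ3.Theorems.Transplant.SharpnessSubdividedCluster
import HarnessLib

/-!
# The subdivided lattice `ℤ^d[L^{(d)}_M]` in every dimension: open clusters versus coarse open clusters

House module of the `TransplantSharpness` programme (P5-SHARPNESS §44.3).  `L^{(d)}_M = gridLinesZd d M` is the set of points
of `ℤ^d` with at most one coordinate not a multiple of `M` — the 1-skeleton of `M · ℤ^d` with every edge subdivided into `M`.
This is `SharpnessSubdividedCluster` with `Site 2` replaced by `Site d` (the only non-verbatim step: a lattice step perpendicular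
to a wall from its interior produces a point with TWO coordinates off the multiples of `M`, hence outside `L^{(d)}_M`):
`percolatesVia (withinGraph ℤ^d L^{(d)}_M) 0 = coarseConfigZd M ⁻¹' percolatesAt 0` (`percolatesVia_gridLines_eqZd`).
-/

noncomputable section

namespace Summit.CriticalPhenomena.PercolationContinuityZ3.Theorems.TransplantSharpness

open Literature.Probability.Percolation Literature.Probability.LatticeModels

variable {d : ℕ}

/-- The grid lines of mesh `M` in `ℤ^d`: points with at most one coordinate not divisible by `M` (for `M ≥ 2` the induced
subgraph is `M ℤ^d` with every edge subdivided into `M` edges). House notation. -/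
def gridLinesZd (d M : ℕ) : Set (Site d) := {x | ∃ i : Fin d, ∀ j, j ≠ i → (M : ℤ) ∣ x j}

/-- `0 ∈ L^{(d)}_M` (`d ≥ 1`). [folklore] -/
theorem zero_mem_gridLinesZd [NeZero d] (M : ℕ) : (0 : Site d) ∈ gridLinesZd d M :=
  ⟨0, fun j _ => by simp⟩

/-! ## Segment points -/

/-- The point `M x + c e_j` of the grid line through the junction `M x` in direction `j` (house notation). -/
def segPtZd (M : ℕ) (x : Site d) (j : Fin d) (c : ℤ) : Site d := (M : ℤ) • x + Pi.single j c

/-- `segPtZd M x j 0 = M x`. [folklore] -/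
@[simp] theorem segPt_zeroZd (M : ℕ) (x : Site d) (j : Fin d) : segPtZd M x j 0 = (M : ℤ) • x := by
  simp [segPtZd]

/-- One more step along the line. [folklore] -/
theorem segPt_add_singleZd (M : ℕ) (x : Site d) (j : Fin d) (c d : ℤ) :
    segPtZd M x j c + Pi.single j d = segPtZd M x j (c + d) := by
  simp [segPtZd, add_assoc, Pi.single_add]

/-- Re-basing a segment point at the neighbouring junction. [folklore] -/
theorem segPt_base_shiftZd (M : ℕ) (x : Site d) (j : Fin d) (a b : ℤ) :
    (M : ℤ) • (x + Pi.single j a) + Pi.single j b = segPtZd M x j ((M : ℤ) * a + b) := by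
  ext k
  rcases eq_or_ne k j with rfl | hk
  · simp only [segPtZd, Pi.add_apply, Pi.smul_apply, smul_eq_mul, Pi.single_eq_same]; ring
  · simp [segPtZd, Pi.single_eq_of_ne hk]

/-- The far end of a wall is the next junction: `M x + (s M) e_j = M (x + s e_j)`. [folklore] -/
theorem segPt_mul_eq_smulZd (M : ℕ) (x : Site d) (j : Fin d) (s : ℤ) :
    segPtZd M x j (s * M) = (M : ℤ) • (x + Pi.single j s) := by
  have h := segPt_base_shiftZd M x j s 0
  rw [Pi.single_zero, add_zero] at h
  rw [h, mul_comm, add_zero]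

/-- Segment points lie on the grid lines. [folklore] -/
theorem segPt_mem_gridLinesZd (M : ℕ) (x : Site d) (j : Fin d) (c : ℤ) : segPtZd M x j c ∈ gridLinesZd d M := by
  refine ⟨j, fun k hk => ?_⟩
  simp [segPtZd, Pi.single_eq_of_ne hk]

/-- Segment points with distinct parameters are distinct. [folklore] -/
theorem segPt_injectiveZd (M : ℕ) (x : Site d) (j : Fin d) : Function.Injective (segPtZd M x j) := by
  intro c d h
  have := congr_fun h j
  simpa [segPtZd] using this

/-- Consecutive segment points are adjacent in `ℤ²`. [folklore] -/
theorem segPt_adj_succZd (M : ℕ) (x : Site d) (j : Fin d) (c : ℤ) :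
    (zdGraph d).Adj (segPtZd M x j c) (segPtZd M x j (c + 1)) := by
  rw [zdGraph_adj_iff]
  exact ⟨j, Or.inl (segPt_add_singleZd M x j c 1).symm⟩

/-- A lattice step is `± e_j`. [folklore] -/
theorem exists_step_of_adjZd {v w : Site d} (h : (zdGraph d).Adj v w) :
    ∃ (j : Fin d) (s : ℤ), (s = 1 ∨ s = -1) ∧ w = v + Pi.single j s := by
  obtain ⟨i, h | h⟩ := (zdGraph_adj_iff v w).1 h
  · exact ⟨i, 1, Or.inl rfl, h⟩
  · refine ⟨i, -1, Or.inr rfl, ?_⟩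
    rw [h, add_assoc, ← Pi.single_add]
    simp

/-! ## From open walls to open coarse edges -/

/-- **A fully open wall opens its coarse edge** (both orientations `s = ±1` of the wall from the junction `M x`).
[folklore] -/
theorem unitEdge_mem_coarseConfig_of_subEdgesZd {M : ℕ} {ω : BondConfig (Site d)} {x : Site d} {j : Fin d} {s : ℤ}
    (hs : s = 1 ∨ s = -1)
    (h : ∀ u : ℤ, 0 ≤ u → u < M → s(segPtZd M x j (s * u), segPtZd M x j (s * (u + 1))) ∈ ω) :
    s(x, x + Pi.single j s) ∈ coarseConfigZd M ω := by
  rcases hs with rfl | rfl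
  · rw [unitEdge_mem_coarseConfig_iffZd]
    intro t ht
    have := h t (by positivity) (by exact_mod_cast ht)
    simp only [one_mul, segPtZd] at this
    exact this
  · -- re-base at `x' = x - e_j`: the wall of `{x', x' + e_j}` read backwards
    set x' : Site d := x + Pi.single j (-1) with hx'
    have hx : x = x' + Pi.single j 1 := by
      rw [hx', add_assoc, ← Pi.single_add]; simp
    rw [show s(x, x') = s(x', x' + Pi.single j (1 : ℤ)) by rw [← hx, Sym2.eq_swap], unitEdge_mem_coarseConfig_iffZd]
    intro t ht
    have hu0 : (0 : ℤ) ≤ (M : ℤ) - 1 - t := by omega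
    have huM : (M : ℤ) - 1 - t < M := by omega
    have e1 : (M : ℤ) • x' + Pi.single j (t : ℤ) = segPtZd M x j (-1 * ((M : ℤ) - 1 - t + 1)) := by
      rw [hx', segPt_base_shiftZd]; congr 1; ring
    have e2 : (M : ℤ) • x' + Pi.single j ((t : ℤ) + 1) = segPtZd M x j (-1 * ((M : ℤ) - 1 - t)) := by
      rw [hx', segPt_base_shiftZd]; congr 1; ring
    show s((M : ℤ) • x' + Pi.single j (t : ℤ), (M : ℤ) • x' + Pi.single j ((t : ℤ) + 1)) ∈ ω
    rw [e1, e2, Sym2.eq_swap]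
    exact h _ hu0 huM

/-- One open coarse step extends the coarse cluster. [folklore] -/
theorem mem_coarseCluster_of_adjZd {M : ℕ} {ω : BondConfig (Site d)} {x y : Site d}
    (hx : x ∈ openCluster (coarseConfigZd M ω) 0) (he : s(x, y) ∈ coarseConfigZd M ω) (hne : x ≠ y) :
    y ∈ openCluster (coarseConfigZd M ω) 0 := by
  change (openGraph (coarseConfigZd M ω)).Reachable 0 y
  exact SimpleGraph.Reachable.trans hx (SimpleGraph.Adj.reachable ((openGraph_adj _ _ _).2 ⟨he, hne⟩))

/-! ## Every vertex of the fine cluster is near a junction of the coarse cluster -/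

/-- `v` is reached from a junction `M x` of the coarse cluster of `0` by an OPEN initial piece, of length `t < M`,
of the wall leaving `M x` in direction `s e_j`. House notation (the induction invariant). -/
def SegGoodZd (M : ℕ) (ω : BondConfig (Site d)) (v : Site d) : Prop :=
  ∃ x : Site d, x ∈ openCluster (coarseConfigZd M ω) 0 ∧ ∃ (j : Fin d) (s : ℤ), (s = 1 ∨ s = -1) ∧
    ∃ t : ℤ, 0 ≤ t ∧ t < M ∧ v = segPtZd M x j (s * t) ∧
      ∀ u : ℤ, 0 ≤ u → u < t → s(segPtZd M x j (s * u), segPtZd M x j (s * (u + 1))) ∈ ω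

/-- The origin is good (it is a junction of its own coarse cluster). [folklore] -/
theorem segGood_zeroZd [NeZero d] {M : ℕ} (hM : 1 ≤ M) (ω : BondConfig (Site d)) : SegGoodZd M ω 0 :=
  ⟨0, mem_openCluster_self _ _, 0, 1, Or.inl rfl, 0, le_rfl, by exact_mod_cast hM, by simp, fun u hu hu' => by omega⟩

/-- **Advancing along an open wall**: from the good position `t` on the wall `(x, j, s)`, the open lattice step to
position `t + 1` leads to a good vertex (a longer open initial piece, or — when `t + 1 = M` — the next junction,
which then belongs to the coarse cluster). [folklore] -/
theorem segGood_forwardZd {M : ℕ} (hM : 1 ≤ M) {ω : BondConfig (Site d)} {x : Site d}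
    (hx : x ∈ openCluster (coarseConfigZd M ω) 0) {j : Fin d} {s : ℤ} (hs : s = 1 ∨ s = -1) {t : ℤ} (ht0 : 0 ≤ t)
    (htM : t < M) (hist : ∀ u : ℤ, 0 ≤ u → u < t → s(segPtZd M x j (s * u), segPtZd M x j (s * (u + 1))) ∈ ω)
    (hnew : s(segPtZd M x j (s * t), segPtZd M x j (s * (t + 1))) ∈ ω) :
    SegGoodZd M ω (segPtZd M x j (s * (t + 1))) := by
  have hist' : ∀ u : ℤ, 0 ≤ u → u < t + 1 → s(segPtZd M x j (s * u), segPtZd M x j (s * (u + 1))) ∈ ω := by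
    intro u hu0 hut
    rcases lt_or_eq_of_le (Int.lt_add_one_iff.1 hut) with h | rfl
    · exact hist u hu0 h
    · exact hnew
  by_cases hlt : t + 1 < M
  · exact ⟨x, hx, j, s, hs, t + 1, by omega, hlt, rfl, hist'⟩
  · have heq : t + 1 = M := by omega
    -- the wall is complete: the coarse edge `{x, x + s e_j}` is open
    have hcoarse : s(x, x + Pi.single j s) ∈ coarseConfigZd M ω :=
      unitEdge_mem_coarseConfig_of_subEdgesZd hs fun u hu0 huM => hist' u hu0 (by omega)
    have hne : x ≠ x + Pi.single j s := by
      intro h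
      have := congr_fun h j
      rcases hs with rfl | rfl <;> simp at this
    have hy := mem_coarseCluster_of_adjZd hx hcoarse hne
    refine ⟨x + Pi.single j s, hy, j, s, hs, 0, le_rfl, by exact_mod_cast hM, ?_, fun u hu hu' => by omega⟩
    rw [heq, segPt_mul_eq_smulZd, mul_zero, segPt_zeroZd]

/-- **The induction step**: a good vertex joined by an open lattice step to a vertex of `L_M` leads to a good
vertex. [folklore] -/
theorem segGood_stepZd {M : ℕ} (hM : 1 ≤ M) {ω : BondConfig (Site d)} {v w : Site d} (hv : SegGoodZd M ω v)
    (hadj : (zdGraph d).Adj v w) (hw : w ∈ gridLinesZd d M) (hopen : s(v, w) ∈ ω) : SegGoodZd M ω w := by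
  obtain ⟨x, hx, j, s, hs, t, ht0, htM, rfl, hist⟩ := hv
  obtain ⟨j', s', hs', rfl⟩ := exists_step_of_adjZd hadj
  rcases eq_or_lt_of_le ht0 with rfl | htpos
  · -- at the junction `M x`: re-align the wall with the step taken
    have h0 : segPtZd M x j (s * 0) = segPtZd M x j' (s' * 0) := by simp
    rw [h0] at hopen ⊢
    rw [segPt_add_singleZd, show s' * 0 + s' = s' * (0 + 1) by ring] at hopen ⊢
    exact segGood_forwardZd hM hx hs' le_rfl (by exact_mod_cast hM) (fun u hu hu' => by omega) hopen
  · rcases eq_or_ne j j' with rfl | hjj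
    · rcases hs' with rfl | rfl <;> rcases hs with rfl | rfl
      · -- forward (`s = s' = 1`)
        rw [segPt_add_singleZd, show (1 : ℤ) * t + 1 = 1 * (t + 1) by ring] at hopen ⊢
        exact segGood_forwardZd hM hx (Or.inl rfl) ht0 htM hist hopen
      · -- backward (`s = -1`, `s' = 1`)
        rw [segPt_add_singleZd, show (-1 : ℤ) * t + 1 = -1 * (t - 1) by ring]
        exact ⟨x, hx, j, -1, Or.inr rfl, t - 1, by omega, by omega, rfl, fun u hu0 hut => hist u hu0 (by omega)⟩
      · -- backward (`s = 1`, `s' = -1`)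
        rw [segPt_add_singleZd, show (1 : ℤ) * t + -1 = 1 * (t - 1) by ring]
        exact ⟨x, hx, j, 1, Or.inl rfl, t - 1, by omega, by omega, rfl, fun u hu0 hut => hist u hu0 (by omega)⟩
      · -- forward (`s = s' = -1`)
        rw [segPt_add_singleZd, show (-1 : ℤ) * t + -1 = -1 * (t + 1) by ring] at hopen ⊢
        exact segGood_forwardZd hM hx (Or.inr rfl) ht0 htM hist hopen
    · -- a perpendicular step from the interior of a wall leaves `L_M`
      exfalso
      have hsj : ¬ (M : ℤ) ∣ (M : ℤ) * x j + s * t := by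
        rw [dvd_add_right (dvd_mul_right _ _)]
        rcases hs with rfl | rfl
        · rw [one_mul]; exact not_dvd_of_pos_of_lt htpos htM
        · rw [neg_one_mul, dvd_neg]; exact not_dvd_of_pos_of_lt htpos htM
      have hsj' : ¬ (M : ℤ) ∣ (M : ℤ) * x j' + s' := by
        rw [dvd_add_right (dvd_mul_right _ _)]
        have h1 : ¬ (M : ℤ) ∣ 1 := not_dvd_of_pos_of_lt one_pos (by omega)
        rcases hs' with rfl | rfl
        · exact h1
        · rw [dvd_neg]; exact h1
      obtain ⟨i, hi⟩ := hw
      rcases eq_or_ne i j with rfl | hij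
      · -- the coordinate `j' ≠ j` of `w` must be a multiple of `M`
        have h := hi j' (Ne.symm hjj)
        simp only [segPtZd, Pi.add_apply, Pi.smul_apply, smul_eq_mul, Pi.single_eq_same,
          Pi.single_eq_of_ne (Ne.symm hjj), add_zero] at h
        exact hsj' h
      · -- the coordinate `j ≠ i` of `w` must be a multiple of `M`
        have h := hi j (Ne.symm hij)
        simp only [segPtZd, Pi.add_apply, Pi.smul_apply, smul_eq_mul, Pi.single_eq_same, Pi.single_eq_of_ne hjj,
          add_zero] at h
        exact hsj h

/-- **Every vertex of the fine cluster of `0` is good.** [folklore] -/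
theorem segGood_of_mem_openClusterInZd [NeZero d] {M : ℕ} (hM : 1 ≤ M) {ω : BondConfig (Site d)} {w : Site d}
    (hw : w ∈ openClusterIn (withinGraph (zdGraph d) (gridLinesZd d M)) ω 0) : SegGoodZd M ω w := by
  rw [mem_openClusterIn_iff, SimpleGraph.reachable_iff_reflTransGen] at hw
  induction hw with
  | refl => exact segGood_zeroZd hM ω
  | tail _ hbc ih =>
    rw [SimpleGraph.inf_adj, openGraph_adj, withinGraph_adj] at hbc
    exact segGood_stepZd hM ih hbc.2.1 hbc.2.2.2 hbc.1.1

/-- A good vertex lies within `ℓ∞`-distance `< M` of a junction of the coarse cluster. [folklore] -/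
theorem near_junction_of_segGoodZd {M : ℕ} {ω : BondConfig (Site d)} {v : Site d} (hv : SegGoodZd M ω v) :
    ∃ x ∈ openCluster (coarseConfigZd M ω) 0,
      v ∈ Set.Icc ((M : ℤ) • x - fun _ => (M : ℤ)) ((M : ℤ) • x + fun _ => (M : ℤ)) := by
  obtain ⟨x, hx, j, s, hs, t, ht0, htM, rfl, -⟩ := hv
  refine ⟨x, hx, ?_, ?_⟩
  · intro k
    simp only [segPtZd, Pi.sub_apply, Pi.add_apply, Pi.smul_apply, smul_eq_mul]
    rcases eq_or_ne k j with rfl | hk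
    · rw [Pi.single_eq_same]; rcases hs with rfl | rfl <;> omega
    · rw [Pi.single_eq_of_ne hk]; omega
  · intro k
    simp only [segPtZd, Pi.add_apply, Pi.smul_apply, smul_eq_mul]
    rcases eq_or_ne k j with rfl | hk
    · rw [Pi.single_eq_same]; rcases hs with rfl | rfl <;> omega
    · rw [Pi.single_eq_of_ne hk]; omega

/-- **If the fine cluster of `0` in `ℤ²[L_M]` is infinite, so is the coarse cluster of `0`.** [folklore] -/
theorem coarseCluster_infiniteZd [NeZero d] {M : ℕ} (hM : 1 ≤ M) {ω : BondConfig (Site d)}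
    (h : (openClusterIn (withinGraph (zdGraph d) (gridLinesZd d M)) ω 0).Infinite) :
    (openCluster (coarseConfigZd M ω) 0).Infinite := by
  by_contra hfin
  rw [Set.not_infinite] at hfin
  apply h
  refine Set.Finite.subset (hfin.biUnion fun x _ =>
    Set.finite_Icc ((M : ℤ) • x - fun _ => (M : ℤ)) ((M : ℤ) • x + fun _ => (M : ℤ))) fun v hv => ?_
  obtain ⟨x, hx, hvx⟩ := near_junction_of_segGoodZd (segGood_of_mem_openClusterInZd hM hv)
  exact Set.mem_biUnion hx hvx

/-! ## From the coarse cluster to the fine cluster -/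

/-- An open wall is an open path of `ℤ²[L_M]`: the junction `M x` reaches every point of the open wall.
[folklore] -/
theorem reachable_segPt_of_wallZd {M : ℕ} {ω : BondConfig (Site d)} {x : Site d} {j : Fin d}
    (hw : ∀ t : ℕ, t < M → wallEdgeZd M x j t ∈ ω) :
    ∀ n : ℕ, n ≤ M → (openGraph ω ⊓ withinGraph (zdGraph d) (gridLinesZd d M)).Reachable ((M : ℤ) • x) (segPtZd M x j n) := by
  intro n
  induction n with
  | zero => intro _; simp
  | succ n ih =>
    intro hn
    refine (ih (Nat.le_of_succ_le hn)).trans (SimpleGraph.Adj.reachable ?_)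
    rw [SimpleGraph.inf_adj, openGraph_adj, withinGraph_adj]
    have hstep : segPtZd M x j ((n + 1 : ℕ) : ℤ) = segPtZd M x j ((n : ℤ) + 1) := by push_cast; rfl
    rw [hstep]
    refine ⟨⟨hw n (Nat.lt_of_succ_le hn), fun h => ?_⟩, segPt_adj_succZd M x j n, segPt_mem_gridLinesZd _ _ _ _,
      segPt_mem_gridLinesZd _ _ _ _⟩
    have := segPt_injectiveZd M x j h
    omega

/-- **An open coarse path lifts to an open path of `ℤ²[L_M]` through the junctions**: `M • C ⊆ C'`. [folklore] -/
theorem smul_mem_openClusterIn_of_mem_coarseClusterZd {M : ℕ} {ω : BondConfig (Site d)} {y : Site d}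
    (hy : y ∈ openCluster (coarseConfigZd M ω) 0) :
    (M : ℤ) • y ∈ openClusterIn (withinGraph (zdGraph d) (gridLinesZd d M)) ω 0 := by
  rw [mem_openClusterIn_iff]
  change (openGraph (coarseConfigZd M ω)).Reachable 0 y at hy
  rw [SimpleGraph.reachable_iff_reflTransGen] at hy
  induction hy with
  | refl => simp
  | tail _ hbc ih =>
    rename_i b c
    refine ih.trans ?_
    obtain ⟨⟨x, j, hxj, hwall⟩, -⟩ := (openGraph_adj _ _ _).1 hbc
    have hreach : (openGraph ω ⊓ withinGraph (zdGraph d) (gridLinesZd d M)).Reachable ((M : ℤ) • x)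
        ((M : ℤ) • (x + Pi.single j 1)) := by
      have h := reachable_segPt_of_wallZd hwall M le_rfl
      rwa [show segPtZd M x j ((M : ℕ) : ℤ) = (M : ℤ) • (x + Pi.single j 1) by rw [← segPt_mul_eq_smulZd, one_mul]] at h
    rcases Sym2.eq_iff.1 hxj with ⟨rfl, rfl⟩ | ⟨rfl, rfl⟩
    · exact hreach
    · exact hreach.symm

/-- **If the coarse cluster of `0` is infinite, so is the fine cluster of `0` in `ℤ²[L_M]`** (`M ≥ 1`). [folklore] -/
theorem openClusterIn_gridLines_infiniteZd {M : ℕ} (hM : 1 ≤ M) {ω : BondConfig (Site d)}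
    (h : (openCluster (coarseConfigZd M ω) 0).Infinite) :
    (openClusterIn (withinGraph (zdGraph d) (gridLinesZd d M)) ω 0).Infinite := by
  have hinj : Set.InjOn (fun y : Site d => (M : ℤ) • y) (openCluster (coarseConfigZd M ω) 0) := by
    intro y _ y' _ hyy
    exact smul_right_injective (Site d) (show (M : ℤ) ≠ 0 by omega) hyy
  refine (h.image hinj).mono ?_
  rintro _ ⟨y, hy, rfl⟩
  exact smul_mem_openClusterIn_of_mem_coarseClusterZd hy

/-! ## The percolation events coincide -/

/-- **`0 ↔ ∞` in `ℤ^d[L^{(d)}_M]` iff `0 ↔ ∞` in the coarse configuration** (`M ≥ 1`): the events are equal. [folklore] -/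
theorem percolatesVia_gridLines_eqZd [NeZero d] {M : ℕ} (hM : 1 ≤ M) :
    percolatesVia (withinGraph (zdGraph d) (gridLinesZd d M)) (0 : Site d) = coarseConfigZd M ⁻¹' percolatesAt 0 := by
  ext ω
  exact ⟨fun h => coarseCluster_infiniteZd hM h, fun h => openClusterIn_gridLines_infiniteZd hM h⟩

end Summit.CriticalPhenomena.PercolationContinuityZ3.Theorems.TransplantSharpness
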